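import Summits.Ventures.WeilGRH.ZetaFlatWindowSpectral
import Summits.Ventures.WeilGRH.FlatWindowAtoms
import HarnessLib

/-!
# rh-explicit (venture WeilGRH): THE WINDOW SEES THE NEIGHBOURS — the necessary side of the
  certificate-length law (`2a·μ{τ} + (4a/3)·μ([τ − 1/a, τ + 1/a] ∖ {τ}) ≤ W_a(e^{−iτx}χ_0)`)

Cell `rh-explicit`, WEIL TRACK (structure seat weil-3, gen10).  Measure level, RH-free; companion of
`ZetaWindowAtomsLimit.lean` (the SUFFICIENT side).  Let `μ` be a positive measure representing Weil's form on
the tests of one window `[-a, a]`, `W(g ⋆ g̃) = ∫‖ĝ(½+it)‖²dμ`, and let `u_{a,τ} = e^{−iτx}χ_0`,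
`χ_0 = (2a)^{-1/2}𝟙_{[-a,a]}`, be the flat window modulated to height `τ`; `‖û_{a,τ}(½+it)‖² =
2sin²(a(t−τ))/(a(t−τ)²)` is the Fejér profile centred at `τ`, `= 2a` at `t = τ`.

The value `W_a(u_{a,τ})` CERTIFIES the bound `μ{τ} ≤ W_a(u_{a,τ})/(2a)` (`ZetaWindowAtomsLimit`:
`two_mul_mul_atom_le_weilWindowForm`), and the certificate is sharp to within `a⁻²·∫_{t≠τ}(t−τ)⁻²dμ`
(`weilWindowForm_modulated_le_atom_add`): a window of half-length `a > √M₂(τ)`, `M₂(τ) = ∫_{t≠τ}(t−τ)⁻²dμ`,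
certifies the multiplicity of an isolated unit atom EXACTLY (`⌊W/(2a)⌋ = μ{τ}`).  This file is the converse
direction — how long the window MUST be:

* `sq_sub_pow_four_div_three_le_sin_sq`: `x² − x⁴/3 ≤ sin²x` on `ℝ` (from `x − x³/6 < sin x`);
* `norm_sq_weilMellin_modulated_ge`: `2a·(1 − a²(t−τ)²/3) ≤ ‖û_{a,τ}(½+it)‖²` for all `t` — the Fejér
  profile stays above `2a·(2/3)` on the whole neighbourhood `|t − τ| ≤ 1/a`;
* **`weilWindowForm_modulated_ge_atom_add_near`** (one window, RH-free): for every `r`,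
  **`2a·μ{τ} + 2a·(1 − (ar)²/3)·μ([τ − r, τ + r] ∖ {τ}) ≤ W_a(u_{a,τ})`** — the window form at rung `a`
  counts, besides the atom at `τ`, at least the fraction `1 − (ar)²/3` of all spectral mass within `r` of `τ`;
* `weilWindowForm_modulated_ge_atom_add_inv` (`r = 1/a`): `2a·μ{τ} + (4a/3)·μ([τ − 1/a, τ + 1/a] ∖ {τ}) ≤ W`;
* **`two_mul_mul_atom_add_one_le_weilWindowForm`** (NO CERTIFICATE BELOW THE LOCAL SPACING): if the punctured
  neighbourhood `[τ − 1/a, τ + 1/a] ∖ {τ}` carries spectral mass `≥ 3/2` — under RH: as soon as TWO other zeros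
  of `ζ` lie within `1/a` of `τ` — then **`2a·(μ{τ} + 1) ≤ W_a(u_{a,τ})`**: the rung-`a` certificate
  `⌊W_a(u_{a,τ})/(2a)⌋` is at least `μ{τ} + 1` and does NOT certify the multiplicity at `τ`;
* `two_mul_mul_atom_add_le_weilWindowForm` (general radius): `k ≤ (1 − (ar)²/3)·μ([τ−r, τ+r] ∖ {τ})` forces
  `2a·(μ{τ} + k) ≤ W_a(u_{a,τ})`;
* `mul_measureReal_Icc_le_weilWindowForm_near`: `2a(1 − (ar)²/3)·μ[τ − r, τ + r] ≤ W_a(u_{a,τ})` (`r ≥ 0`) — the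
  short-interval count of `ZetaWindowAtomsLimit` (`(8a/π²)·μ[τ ± π/(2a)] ≤ W`, Jordan) with the better constant
  near the centre (`4a/3` vs `8a/π² = 0.81a` at `r = 1/a`).

THE CERTIFICATE-LENGTH LAW, TWO-SIDED.  Writing `a*(τ)` for the infimum of the rungs `a` whose window certifies
the multiplicity at `τ` exactly and `d₂(τ)` for the distance from `τ` to the second-nearest other point of the
support of `μ` (unit atoms): **`1/d₂(τ) ≤ a*(τ) ≤ √M₂(τ)`**, `M₂(τ) = Σ_{γ ≠ τ} m_γ (γ − τ)⁻² ≥ d₁⁻² + d₂⁻²`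
— both bounds are local zero-spacing statistics; this is why a fixed window certifies a decreasing fraction of
the zeros of `ζ` as the height (and the density `log(γ/2π)/2π`) grows (kit census j205209: the window `a = 1`
certifies 81 % of the zeros with `γ < 237` simple, 11 % of those with `γ ∈ [600, 743]`).

No definitions, no named facts; RH-free.
-/

set_option autoImplicit false

noncomputable section

open Complex Filter Set MeasureTheory
open scoped Real Topology ComplexConjugate

namespace Summit.Ventures.WeilGRH

open Literature.NumberTheory.LFunctions
open Literature.NumberTheory.LFunctions.Yoshida1992 (chi chiCore)
open Summit.RiemannHypothesis.RiemannHypothesis.Theorems.WeilFormatC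
open Summit.RiemannHypothesis.RiemannHypothesis.Theorems.WeilBochnerMeasure (weilWindowForm_eq_integral
  integrable_inv_one_add_sq)

variable {a : ℝ}

/-! ## The Fejér profile near its centre: a polynomial minorant -/

/-- `x² − x⁴/3 ≤ sin² x` for every real `x` (square `x − x³/6 < sin x` for `0 < x ≤ √6`; trivial beyond). -/
theorem sq_sub_pow_four_div_three_le_sin_sq (x : ℝ) : x ^ 2 - x ^ 4 / 3 ≤ Real.sin x ^ 2 := by
  wlog hx : 0 < x generalizing x
  · rcases (not_lt.1 hx).eq_or_lt with h | h
    · subst h; simp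
    · have h' := this (-x) (by linarith)
      rw [Real.sin_neg, neg_sq, neg_sq, show (-x) ^ 4 = x ^ 4 by ring] at h'
      exact h'
  by_cases h6 : x ^ 2 ≤ 6
  · have h := Real.sin_gt_sub_cube hx
    have h0 : 0 ≤ x - x ^ 3 / 6 := by nlinarith
    have h1 : (x - x ^ 3 / 6) ^ 2 ≤ Real.sin x ^ 2 := pow_le_pow_left₀ h0 h.le 2
    have h2 : (x - x ^ 3 / 6) ^ 2 = x ^ 2 - x ^ 4 / 3 + x ^ 6 / 36 := by ring
    have h3 : 0 ≤ x ^ 6 := by positivity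
    linarith
  · have hm : x ^ 2 * 6 ≤ x ^ 2 * x ^ 2 := mul_le_mul_of_nonneg_left (not_le.1 h6).le (sq_nonneg x)
    have h4 : x ^ 4 = x ^ 2 * x ^ 2 := by ring
    nlinarith [sq_nonneg (Real.sin x), sq_nonneg x]

/-- **The Fejér profile near its centre**: `2a·(1 − a²(t−τ)²/3) ≤ ‖û_{a,τ}(½+it)‖²` for every `t`
(equality `2a` at `t = τ`; the bound is void for `a|t − τ| ≥ √3`). -/
theorem norm_sq_weilMellin_modulated_ge (ha : 0 < a) (τ t : ℝ) :
    2 * a * (1 - a ^ 2 * (t - τ) ^ 2 / 3) ≤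
      ‖weilMellin (fun x ↦ cexp (I * ((-τ) * x : ℝ)) * chi a 0 x) (1 / 2 + t * I)‖ ^ 2 := by
  rw [weilMellin_modulated_chi_zero]
  rcases eq_or_ne t τ with rfl | ht
  · rw [show t + -t = (0 : ℝ) by ring, norm_sq_weilMellin_chi_zero_zero ha]
    simp
  · have hs : t + -τ ≠ 0 := by rw [← sub_eq_add_neg]; exact sub_ne_zero.2 ht
    rw [norm_sq_weilMellin_chi_zero ha hs]
    set s := t + -τ with hs_def
    have hst : t - τ = s := by rw [hs_def, sub_eq_add_neg]
    rw [hst]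
    have hs2 : 0 < s ^ 2 := by positivity
    rw [le_div_iff₀ (by positivity)]
    have key := sq_sub_pow_four_div_three_le_sin_sq (a * s)
    calc 2 * a * (1 - a ^ 2 * s ^ 2 / 3) * (a * s ^ 2) = 2 * ((a * s) ^ 2 - (a * s) ^ 4 / 3) := by ring
      _ ≤ 2 * Real.sin (a * s) ^ 2 := by linarith

/-- A measure integrating `(1+t²)⁻¹` gives finite mass to every bounded interval. -/
private theorem measure_Icc_lt_top_aux {μ : Measure ℝ} (hI : Integrable (fun t : ℝ ↦ (1 + t ^ 2)⁻¹) μ)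
    (b c : ℝ) : μ (Icc b c) < ⊤ := by
  set R : ℝ := max |b| |c| with hR
  have hε : (0 : ℝ) < (1 + R ^ 2)⁻¹ := by positivity
  refine lt_of_le_of_lt (measure_mono fun t ht ↦ ?_) (hI.measure_norm_ge_lt_top hε)
  have htR : |t| ≤ R := abs_le.2 ⟨by linarith [ht.1, neg_abs_le b, le_max_left |b| |c|],
    by linarith [ht.2, le_abs_self c, le_max_right |b| |c|]⟩
  have ht2 : t ^ 2 ≤ R ^ 2 := by rw [← sq_abs t]; exact pow_le_pow_left₀ (abs_nonneg t) htR 2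
  show (1 + R ^ 2)⁻¹ ≤ ‖(1 + t ^ 2)⁻¹‖
  rw [Real.norm_of_nonneg (by positivity)]
  exact inv_anti₀ (by positivity) (by linarith)

/-! ## One window counts the atom AND its neighbours -/

/-- **THE WINDOW SEES THE NEIGHBOURS** (one window, RH-free).  For `a > 0`, every positive `μ` representing
Weil's form on the tests of `[-a, a]`, every height `τ` and every radius `r`:

  `2a·μ{τ} + 2a·(1 − (ar)²/3)·μ([τ − r, τ + r] ∖ {τ}) ≤ weilWindowForm a (e^{−iτx}χ_0)`. -/
theorem weilWindowForm_modulated_ge_atom_add_near (ha : 0 < a) {μ : Measure ℝ}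
    (hμ : ∀ g : ℝ → ℂ, IsWeilTest g → tsupport g ⊆ Icc (-a) a →
      Integrable (fun t : ℝ ↦ ‖weilMellin g (1 / 2 + t * I)‖ ^ 2) μ ∧
        weilQuadratic g = ((∫ t, ‖weilMellin g (1 / 2 + t * I)‖ ^ 2 ∂μ : ℝ) : ℂ)) (τ r : ℝ) :
    2 * a * μ.real {τ} + 2 * a * (1 - (a * r) ^ 2 / 3) * μ.real (Icc (τ - r) (τ + r) \ {τ}) ≤
      weilWindowForm a (fun x ↦ cexp (I * ((-τ) * x : ℝ)) * chi a 0 x) := by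
  obtain ⟨hf, huf⟩ := modulated_chi_zero_smooth_inside a (-τ)
  obtain ⟨hint, heq⟩ :=
    weilWindowForm_eq_integral ha hμ (isWindowFunction_modulated_chi_zero ha (-τ)) hf huf
  set u : ℝ → ℂ := fun x ↦ cexp (I * ((-τ) * x : ℝ)) * chi a 0 x with hu
  set B : Set ℝ := Icc (τ - r) (τ + r) \ {τ} with hB
  set c : ℝ := 2 * a * (1 - (a * r) ^ 2 / 3) with hc
  have hI := integrable_inv_one_add_sq ha hμ
  have hBm : MeasurableSet B := measurableSet_Icc.diff (measurableSet_singleton τ)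
  have hBf : μ B < ⊤ := lt_of_le_of_lt (measure_mono sdiff_subset) (measure_Icc_lt_top_aux hI _ _)
  have h0 : μ {τ} < ⊤ := measure_singleton_lt_top_of_integrable hI τ
  have hind1 : Integrable (fun t : ℝ ↦ ({τ} : Set ℝ).indicator (fun _ ↦ 2 * a) t) μ :=
    (integrable_indicator_iff (measurableSet_singleton τ)).2 (integrableOn_const h0.ne)
  have hind2 : Integrable (fun t : ℝ ↦ B.indicator (fun _ ↦ c) t) μ :=
    (integrable_indicator_iff hBm).2 (integrableOn_const hBf.ne)
  have hle : ∀ t : ℝ, ({τ} : Set ℝ).indicator (fun _ ↦ 2 * a) t + B.indicator (fun _ ↦ c) t ≤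
      ‖weilMellin u (1 / 2 + t * I)‖ ^ 2 := by
    intro t
    by_cases h1 : t ∈ ({τ} : Set ℝ)
    · have h2 : t ∉ B := fun h ↦ h.2 h1
      rw [indicator_of_mem h1, indicator_of_notMem h2, add_zero, mem_singleton_iff.1 h1, hu,
        norm_sq_weilMellin_modulated_chi_zero_self ha]
    · rw [indicator_of_notMem h1, zero_add]
      by_cases h2 : t ∈ B
      · rw [indicator_of_mem h2]
        have ht : (t - τ) ^ 2 ≤ r ^ 2 := by
          have h3 := h2.1
          exact sq_le_sq' (by linarith [h3.1]) (by linarith [h3.2])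
        calc c = 2 * a * (1 - a ^ 2 * r ^ 2 / 3) := by rw [hc]; ring
          _ ≤ 2 * a * (1 - a ^ 2 * (t - τ) ^ 2 / 3) := by gcongr
          _ ≤ ‖weilMellin u (1 / 2 + t * I)‖ ^ 2 := norm_sq_weilMellin_modulated_ge ha τ t
      · rw [indicator_of_notMem h2]; positivity
  calc 2 * a * μ.real {τ} + c * μ.real B
        = ∫ t, (({τ} : Set ℝ).indicator (fun _ ↦ 2 * a) t + B.indicator (fun _ ↦ c) t) ∂μ := by
        rw [integral_add hind1 hind2, integral_indicator_const _ (measurableSet_singleton τ),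
          integral_indicator_const _ hBm, smul_eq_mul, smul_eq_mul]
        ring
    _ ≤ ∫ t, ‖weilMellin u (1 / 2 + t * I)‖ ^ 2 ∂μ := integral_mono (hind1.add hind2) hint hle
    _ = weilWindowForm a u := heq.symm

/-- `r = 1/a`: **`2a·μ{τ} + (4a/3)·μ([τ − 1/a, τ + 1/a] ∖ {τ}) ≤ W_a(e^{−iτx}χ_0)`** — the window at rung
`a` counts at least two thirds of every neighbour within `1/a`. -/
theorem weilWindowForm_modulated_ge_atom_add_inv (ha : 0 < a) {μ : Measure ℝ}
    (hμ : ∀ g : ℝ → ℂ, IsWeilTest g → tsupport g ⊆ Icc (-a) a →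
      Integrable (fun t : ℝ ↦ ‖weilMellin g (1 / 2 + t * I)‖ ^ 2) μ ∧
        weilQuadratic g = ((∫ t, ‖weilMellin g (1 / 2 + t * I)‖ ^ 2 ∂μ : ℝ) : ℂ)) (τ : ℝ) :
    2 * a * μ.real {τ} + 4 * a / 3 * μ.real (Icc (τ - a⁻¹) (τ + a⁻¹) \ {τ}) ≤
      weilWindowForm a (fun x ↦ cexp (I * ((-τ) * x : ℝ)) * chi a 0 x) := by
  have h := weilWindowForm_modulated_ge_atom_add_near ha hμ τ a⁻¹
  rw [mul_inv_cancel₀ ha.ne', show 2 * a * (1 - (1 : ℝ) ^ 2 / 3) = 4 * a / 3 by ring] at h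
  exact h

/-- **NO CERTIFICATE BELOW THE LOCAL SPACING** (one window, RH-free).  If the punctured neighbourhood
`[τ − 1/a, τ + 1/a] ∖ {τ}` carries spectral mass `≥ 3/2` — under RH: as soon as two other zeros of `ζ` lie
within `1/a` of `τ` — then **`2a·(μ{τ} + 1) ≤ weilWindowForm a (e^{−iτx}χ_0)`**: the rung-`a` certificate
`⌊W_a/(2a)⌋ ≥ μ{τ} + 1` cannot certify the multiplicity at `τ`.  With the sufficient side
(`ZetaWindowAtomsLimit.weilWindowForm_modulated_le_atom_add`: `a > √M₂(τ)` certifies) this is the two-sided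
CERTIFICATE-LENGTH LAW `1/d₂(τ) ≤ a*(τ) ≤ √M₂(τ)`. -/
theorem two_mul_mul_atom_add_one_le_weilWindowForm (ha : 0 < a) {μ : Measure ℝ}
    (hμ : ∀ g : ℝ → ℂ, IsWeilTest g → tsupport g ⊆ Icc (-a) a →
      Integrable (fun t : ℝ ↦ ‖weilMellin g (1 / 2 + t * I)‖ ^ 2) μ ∧
        weilQuadratic g = ((∫ t, ‖weilMellin g (1 / 2 + t * I)‖ ^ 2 ∂μ : ℝ) : ℂ)) {τ : ℝ}
    (hnear : 3 / 2 ≤ μ.real (Icc (τ - a⁻¹) (τ + a⁻¹) \ {τ})) :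
    2 * a * (μ.real {τ} + 1) ≤ weilWindowForm a (fun x ↦ cexp (I * ((-τ) * x : ℝ)) * chi a 0 x) := by
  have h := weilWindowForm_modulated_ge_atom_add_inv ha hμ τ
  have h' := mul_le_mul_of_nonneg_left hnear ha.le
  linarith

/-- General radius: if `k ≤ (1 − (ar)²/3)·μ([τ − r, τ + r] ∖ {τ})` then `2a·(μ{τ} + k) ≤ W_a(e^{−iτx}χ_0)`. -/
theorem two_mul_mul_atom_add_le_weilWindowForm (ha : 0 < a) {μ : Measure ℝ}
    (hμ : ∀ g : ℝ → ℂ, IsWeilTest g → tsupport g ⊆ Icc (-a) a →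
      Integrable (fun t : ℝ ↦ ‖weilMellin g (1 / 2 + t * I)‖ ^ 2) μ ∧
        weilQuadratic g = ((∫ t, ‖weilMellin g (1 / 2 + t * I)‖ ^ 2 ∂μ : ℝ) : ℂ)) {τ r k : ℝ}
    (hnear : k ≤ (1 - (a * r) ^ 2 / 3) * μ.real (Icc (τ - r) (τ + r) \ {τ})) :
    2 * a * (μ.real {τ} + k) ≤ weilWindowForm a (fun x ↦ cexp (I * ((-τ) * x : ℝ)) * chi a 0 x) := by
  have h := weilWindowForm_modulated_ge_atom_add_near ha hμ τ r
  have h' := mul_le_mul_of_nonneg_left hnear ha.le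
  linarith

/-- **Short-interval count with the better constant near the centre** (one window, RH-free): for `r ≥ 0`,
`2a·(1 − (ar)²/3)·μ[τ − r, τ + r] ≤ weilWindowForm a (e^{−iτx}χ_0)` — at `r = 1/a` the constant is `4a/3`
(Jordan's on `[τ ± π/(2a)]`, `ZetaWindowAtomsLimit.mul_measureReal_Icc_le_weilWindowForm`, is `8a/π²`). -/
theorem mul_measureReal_Icc_le_weilWindowForm_near (ha : 0 < a) {μ : Measure ℝ}
    (hμ : ∀ g : ℝ → ℂ, IsWeilTest g → tsupport g ⊆ Icc (-a) a →
      Integrable (fun t : ℝ ↦ ‖weilMellin g (1 / 2 + t * I)‖ ^ 2) μ ∧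
        weilQuadratic g = ((∫ t, ‖weilMellin g (1 / 2 + t * I)‖ ^ 2 ∂μ : ℝ) : ℂ)) (τ : ℝ) {r : ℝ}
    (hr : 0 ≤ r) :
    2 * a * (1 - (a * r) ^ 2 / 3) * μ.real (Icc (τ - r) (τ + r)) ≤
      weilWindowForm a (fun x ↦ cexp (I * ((-τ) * x : ℝ)) * chi a 0 x) := by
  have h := weilWindowForm_modulated_ge_atom_add_near ha hμ τ r
  have hI := integrable_inv_one_add_sq ha hμ
  have hsub : ({τ} : Set ℝ) ⊆ Icc (τ - r) (τ + r) := by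
    rw [singleton_subset_iff]; exact ⟨by linarith, by linarith⟩
  have hsplit : μ.real (Icc (τ - r) (τ + r)) = μ.real (Icc (τ - r) (τ + r) \ {τ}) + μ.real {τ} := by
    rw [← measureReal_union disjoint_sdiff_left (measurableSet_singleton τ)
      (lt_of_le_of_lt (measure_mono sdiff_subset) (measure_Icc_lt_top_aux hI _ _)).ne
      (measure_singleton_lt_top_of_integrable hI τ).ne, sdiff_union_of_subset hsub]
  have hm0 : 0 ≤ μ.real {τ} := measureReal_nonneg
  have hc : 2 * a * (1 - (a * r) ^ 2 / 3) * μ.real {τ} ≤ 2 * a * μ.real {τ} := by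
    have : 0 ≤ 2 * a * ((a * r) ^ 2 / 3) * μ.real {τ} := by positivity
    nlinarith
  rw [hsplit, mul_add]
  linarith
-- Build note (weil-3 gen14, 2026-08-24): byte-identical re-land under lead ruling R14-3 (APPEND REMEDY) to trigger the hub build; p372495 accepted 2026-08-23T22:46Z.
end Summit.Ventures.WeilGRH

end
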